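import Mathlib
import Literature.NumberTheory.RationalReconstruction.Uniqueness

/-!
# X-adic lifting for nonsingular linear systems: Dixon's algorithm and the linear / quadratic
# lifting identities (Dixon 1982; Pauderis–Storjohann 2012, §1–§2)

Topic `Literature/LinearAlgebra/Matrix`. The exact solution of a nonsingular linear system
`A x = b`, `A ∈ ℤⁿˣⁿ`, by *`X`-adic (for `X = p`, `p`-adic) lifting* [Dixon1982]: from a *local
inverse* `C₀ = Rem(A⁻¹, X)` one produces the `X`-adic digits `y₀, y₁, …` of `A⁻¹ b` by the linear
recurrence "dixonDigit `yᵢ = Rem(C₀ rᵢ, X)`, residue `rᵢ₊₁ = (rᵢ − A yᵢ)/X`", so that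
`x⁽ᵏ⁾ = Σ_{i<k} yᵢ Xⁱ` satisfies `A x⁽ᵏ⁾ ≡ b (mod Xᵏ)`, and recovers the rational solution by
rational number reconstruction once `Xᵏ` exceeds twice the product of the numerator and denominator
bounds.
The matrix form and its quadratic (Newton) variant are §2 of [PauderisStorjohann2012], whose
numbered statements we follow (held text `paper:doi-10-1145-2442829-2442870`, pp. 2–4; the
extraction of the two-column pages is garbled in places, the statements below are transcribed):

* **`Rem(a, X)`** [PauderisStorjohann2012, §1 p. 2]: «we let `Rem(a, X)` denote the unique integer
  in the usual "symmetric range" modulo `X`, that is, `Rem(a, X) ≡ a mod X` and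
  `Rem(a, X) ∈ [−⌊(X−1)/2⌋, ⌊X/2⌋]`»; «The next two lemmas follow directly from the above
  definition. **Lemma 1.** `|Rem(∗, X)|/X ≤ 1/2`. **Lemma 2.** If `a ∈ ℤ` satisfies `|a| < X/2`
  then `Rem(a, X) = a`.» — `symmRem`, `two_mul_abs_symmRem_le`, `symmRem_eq_self_of_two_mul_abs_lt`.
* **§2.1 Linear lifting** (p. 3): «Linear `X`-adic lifting is based on the identity
  `A⁻¹ = C₀ + C₁X + ⋯ + C_{i−1}X^{i−1} + A⁻¹RᵢXⁱ` (1), where the residue `Rᵢ` is equal to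
  `Rᵢ = (1/Xⁱ)(I − A·Rem(A⁻¹, Xⁱ))` (2). If `Rᵢ` is known, the next coefficient `Cᵢ` in the
  `X`-adic expansion of `A⁻¹` can be computed using `Cᵢ = Rem(C₀Rᵢ, X)`, and the next residue
  using `Rᵢ₊₁ = (1/X)(Rᵢ − ACᵢ)` (3). … **Theorem 3.** Let `A ∈ ℤⁿˣⁿ` be nonsingular and
  `X ∈ ℤ_{>2}` be relatively prime to `det A`. If `B, R ∈ ℤⁿˣⁿ` satisfy `A⁻¹ = B + A⁻¹RXᵏ` for
  some `k > 0`, then for any `M ∈ ℤⁿˣⁿ` such that `M ≡ A⁻¹R mod Xˡ` for some `l > 0`, we have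
  `A⁻¹ = B + MXᵏ + A⁻¹R′X^{k+l}`, where `R′ := (1/Xˡ)(R − AM)`. In particular, we can choose
  `l = 1` and `M := Rem(A⁻¹R, X)`.»
* **§2.2 Quadratic lifting** (pp. 3–4): «quadratic lifting, also known as algebraic Newton
  iteration, is based on the identity `A⁻¹ = Rem(A⁻¹, X^{2^i}) + A⁻¹RX^{2^i}` (4) …
  `A⁻¹ ≡ Rem(A⁻¹, X^{2^i})(I + RX^{2^i}) mod X^{2^{i+1}}` … **Theorem 4.** Let `A ∈ ℤⁿˣⁿ` be
  nonsingular and `X ∈ ℤ_{>2}` be relatively prime to `det A`. For any `B, R ∈ ℤⁿˣⁿ` that satisfy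
  `A⁻¹ = B + A⁻¹RX` we have `A⁻¹ = B(I + RX) + A⁻¹R²X²`.»

## What is formalised, and in which form

Multiplying the identities of Theorems 3 and 4 by `A` turns them into *integral* identities
(`A B + Xᵏ R = I` in place of `A⁻¹ = B + A⁻¹ R Xᵏ`), meaningful over any commutative ring and
equivalent to the printed ones whenever `A` is invertible over the fraction field; we state and
prove them in that form (`linearLifting`, `linearLifting_localInverse`, `quadraticLifting`), over
an arbitrary commutative ring `R` and modulus `X : R`. Dixon's vector iteration is set up over the
same generality with the local inverse and the reduction `Rem(·, X)` abstracted into the data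
`LocalInverse A X` (`A C = I + X E`) and `DigitReduction ι R X` (`reduce v + X • quot v = v`;
instances:
no reduction, `ℤ` with digits in `[0, X)`, `ℤ` with digits in the symmetric range); the theorems
are the exact-division recurrence `X • rᵢ₊₁ = rᵢ − A yᵢ` (`smul_dixonResidual_succ`), the lifting
invariant `A x⁽ᵏ⁾ + Xᵏ rₖ = b` (`mulVec_dixonApprox_add`, eq. (1) for a right-hand side), its
adjugate
form `det A • x⁽ᵏ⁾ + Xᵏ adj(A) rₖ = adj(A) b`, and over `ℤ`: the congruence
`det A · x⁽ᵏ⁾ⱼ ≡ (adj(A) b)ⱼ (mod Xᵏ)`, the magnitude invariants (digits in `[0, X)`,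
`0 ≤ x⁽ᵏ⁾ⱼ < Xᵏ`, `‖rᵢ‖∞ ≤ max(‖b‖∞, n‖A‖∞)` — the reason the iteration runs in fixed precision),
and **Dixon's output criterion**: any fraction `u/v` with `v x⁽ᵏ⁾ⱼ ≡ u (mod Xᵏ)` inside the
rational-reconstruction bounds equals `(adj(A) b)ⱼ / det A = (A⁻¹ b)ⱼ`
(`reconstruction_mul_det_eq`, via the tree's
`Literature.NumberTheory.RationalReconstruction.eq_of_modEq_of_two_mul_lt`
[GathenGerhard1999, Thm. 5.26]). A local inverse is built from an inverse of `det A` modulo `X`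
(`LocalInverse.ofDet`, `LocalInverse.ofIsCoprime`). Cite tags name the held source
[PauderisStorjohann2012] (and [GathenGerhard1999] for the reconstruction step); [Dixon1982], the
origin of the vector iteration and of the output criterion, is not held here (acquisition requested)
and is cited in prose only. Not formalised: running-time statements, the double-plus-one /
high-order lifting of [PauderisStorjohann2012, §3–§5].
-/

open Matrix Finset

namespace Literature.LinearAlgebra.Matrix.XAdicLifting

/-! ## §1. The symmetric remainder `Rem(a, X)` [PauderisStorjohann2012, §1, Lemmas 1–2] -/

section Rem

/-- `Rem(a, X)`: the representative of `a` modulo `X` in the symmetric range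
`[−⌊(X−1)/2⌋, ⌊X/2⌋]` (for `X > 0`). [cite: PauderisStorjohann2012, §1 p. 2 (definition of Rem)] -/
def symmRem (X a : ℤ) : ℤ := if X < 2 * (a % X) then a % X - X else a % X

/-- `Rem(a, X) ≡ a (mod X)`. [cite: PauderisStorjohann2012, §1 p. 2 (definition of Rem)] -/
theorem symmRem_modEq (X a : ℤ) : symmRem X a ≡ a [ZMOD X] := by
  unfold symmRem
  split_ifs
  · calc a % X - X ≡ a % X [ZMOD X] := Int.modEq_iff_dvd.mpr ⟨1, by ring⟩
      _ ≡ a [ZMOD X] := Int.mod_modEq a X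
  · exact Int.mod_modEq a X

/-- `X ∣ a − Rem(a, X)`. [cite: PauderisStorjohann2012, §1 p. 2 (definition of Rem)] -/
theorem dvd_sub_symmRem (X a : ℤ) : X ∣ a - symmRem X a := (symmRem_modEq X a).dvd

/-- Upper end of the symmetric range: `2 · Rem(a, X) ≤ X`, i.e. `Rem(a, X) ≤ ⌊X/2⌋`.
[cite: PauderisStorjohann2012, §1 p. 2 (definition of Rem)] -/
theorem two_mul_symmRem_le {X : ℤ} (hX : 0 < X) (a : ℤ) : 2 * symmRem X a ≤ X := by
  unfold symmRem
  have h1 : a % X < X := Int.emod_lt_of_pos a hX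
  split_ifs with h
  · linarith
  · linarith

/-- Lower end of the symmetric range: `−X < 2 · Rem(a, X)`, i.e. `−⌊(X−1)/2⌋ ≤ Rem(a, X)`.
[cite: PauderisStorjohann2012, §1 p. 2 (definition of Rem)] -/
theorem neg_lt_two_mul_symmRem {X : ℤ} (hX : 0 < X) (a : ℤ) : -X < 2 * symmRem X a := by
  unfold symmRem
  have h0 : 0 ≤ a % X := Int.emod_nonneg a hX.ne'
  split_ifs with h
  · linarith
  · linarith

/-- **[PauderisStorjohann2012, Lemma 1]**: `|Rem(a, X)| / X ≤ 1/2`, here as `2 |Rem(a, X)| ≤ X`.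
[cite: PauderisStorjohann2012, Lemma 1] -/
theorem two_mul_abs_symmRem_le {X : ℤ} (hX : 0 < X) (a : ℤ) : 2 * |symmRem X a| ≤ X := by
  have h1 := two_mul_symmRem_le hX a
  have h2 := neg_lt_two_mul_symmRem hX a
  rcases le_or_gt 0 (symmRem X a) with h | h
  · rw [abs_of_nonneg h]; exact h1
  · rw [abs_of_neg h]; linarith

/-- Uniqueness of the representative in the symmetric range: an `r ≡ a (mod X)` with
`−X < 2r ≤ X` is `Rem(a, X)`. [cite: PauderisStorjohann2012, §1 p. 2 (definition of Rem)] -/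
theorem symmRem_eq_of_modEq {X a r : ℤ} (hX : 0 < X) (hr : r ≡ a [ZMOD X]) (h1 : -X < 2 * r)
    (h2 : 2 * r ≤ X) : symmRem X a = r := by
  unfold symmRem
  rcases le_or_gt 0 r with h | h
  · have hlt : r < X := by linarith
    have hmod : a % X = r := by rw [← hr]; exact Int.emod_eq_of_lt h hlt
    rw [hmod, if_neg (by linarith)]
  · have hmod : a % X = r + X := by
      have h' : r + X ≡ a [ZMOD X] := (Int.modEq_iff_dvd.mpr ⟨-1, by ring⟩).trans hr
      rw [← h']
      exact Int.emod_eq_of_lt (by linarith) (by linarith)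
    rw [hmod, if_pos (by linarith)]
    ring

/-- **[PauderisStorjohann2012, Lemma 2]**: if `|a| < X/2` then `Rem(a, X) = a`.
[cite: PauderisStorjohann2012, Lemma 2] -/
theorem symmRem_eq_self_of_two_mul_abs_lt {X a : ℤ} (hX : 0 < X) (h : 2 * |a| < X) :
    symmRem X a = a :=
  symmRem_eq_of_modEq hX (Int.ModEq.refl a) (by linarith [neg_abs_le a])
    (by linarith [le_abs_self a])

/-- `Rem(Rem(a, X), X) = Rem(a, X)`. [cite: PauderisStorjohann2012, §1 p. 2 (definition of Rem)] -/
theorem symmRem_symmRem {X : ℤ} (hX : 0 < X) (a : ℤ) : symmRem X (symmRem X a) = symmRem X a :=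
  symmRem_eq_of_modEq hX (Int.ModEq.refl _) (neg_lt_two_mul_symmRem hX a) (two_mul_symmRem_le hX a)

end Rem

/-! ## §2. The lifting identities over a commutative ring [PauderisStorjohann2012, Thms. 3–4]

Integral forms: `A B + Xᵏ E = I` replaces `A⁻¹ = B + A⁻¹ E Xᵏ` (multiply by `A`). -/

section Identities

variable {ι R : Type*} [Fintype ι] [DecidableEq ι] [CommRing R]

/-- **[PauderisStorjohann2012, Theorem 3]** (the essence of linear `X`-adic lifting), integral
form over a commutative ring: if `A B + Xᵏ E = I` ("`B` inverts `A` to precision `k` with residue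
`E`") and `E = A M + Xˡ E′` ("`M ≡ A⁻¹E (mod Xˡ)`, `E′ = (E − AM)/Xˡ`"), then
`A (B + Xᵏ M) + X^{k+l} E′ = I` ("`B + M Xᵏ` inverts `A` to precision `k + l` with residue `E′`").
[cite: PauderisStorjohann2012, Theorem 3] -/
theorem linearLifting {A B E M E' : Matrix ι ι R} {X : R} {k l : ℕ}
    (h : A * B + X ^ k • E = 1) (hM : E = A * M + X ^ l • E') :
    A * (B + X ^ k • M) + X ^ (k + l) • E' = 1 := by
  have e1 : A * (B + X ^ k • M) = A * B + X ^ k • (A * M) := by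
    rw [mul_add, Matrix.mul_smul]
  have e2 : X ^ (k + l) • E' = X ^ k • (X ^ l • E') := by rw [pow_add, mul_smul]
  rw [e1, e2, add_assoc, ← smul_add, ← hM]
  exact h

/-- The step actually iterated ([PauderisStorjohann2012, Theorem 3] with `l = 1` and
`M := Rem(C₀E, X)`, eq. (3): `Cᵢ = Rem(C₀Rᵢ, X)`, `Rᵢ₊₁ = (Rᵢ − ACᵢ)/X`): from a local inverse
`A C = I + X F` and any reduction `M = C E − X Q` of `C E` modulo `X`, the residue at precision
`k + 1` is `E′ = A Q − F E`, with no division. [cite: PauderisStorjohann2012, Theorem 3, eq. (3)] -/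
theorem linearLifting_localInverse {A B C E F Q : Matrix ι ι R} {X : R} {k : ℕ}
    (hC : A * C = 1 + X • F) (h : A * B + X ^ k • E = 1) :
    A * (B + X ^ k • (C * E - X • Q)) + X ^ (k + 1) • (A * Q - F * E) = 1 := by
  refine linearLifting h ?_
  rw [pow_one, Matrix.mul_sub, ← Matrix.mul_assoc, hC, Matrix.add_mul, Matrix.one_mul,
    Matrix.smul_mul, Matrix.mul_smul, smul_sub]
  abel

/-- **[PauderisStorjohann2012, Theorem 4]** (the essence of quadratic `X`-adic lifting /
algebraic Newton iteration, eqs. (4)–(5)), integral form over a commutative ring: if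
`A B + X E = I` then `A (B (I + X E)) + X² E² = I` — the precision doubles and the new residue is
the square of the old one. [cite: PauderisStorjohann2012, Theorem 4] -/
theorem quadraticLifting {A B E : Matrix ι ι R} {X : R} (h : A * B + X • E = 1) :
    A * (B * (1 + X • E)) + X ^ 2 • (E * E) = 1 := by
  have hAB : A * B = 1 - X • E := eq_sub_of_add_eq h
  rw [← Matrix.mul_assoc, hAB, Matrix.sub_mul, Matrix.one_mul, Matrix.mul_add, Matrix.mul_one,
    Matrix.smul_mul, Matrix.mul_smul, smul_smul, sq]
  abel

/-- Iterating [PauderisStorjohann2012, Theorem 4]: from `A B₀ + X E₀ = I`, the pairs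
`Bᵢ₊₁ = Bᵢ (I + X^{2^i} Eᵢ)`, `Eᵢ₊₁ = Eᵢ²` satisfy `A Bᵢ + X^{2^i} Eᵢ = I` (eq. (5): `Rᵢ = Rᵢ₋₁²`).
[cite: PauderisStorjohann2012, Theorem 4, eq. (5)] -/
theorem quadraticLifting_iterate {A : Matrix ι ι R} {X : R} (B E : ℕ → Matrix ι ι R)
    (h0 : A * B 0 + X • E 0 = 1) (hB : ∀ i, B (i + 1) = B i * (1 + X ^ 2 ^ i • E i))
    (hE : ∀ i, E (i + 1) = E i * E i) (i : ℕ) : A * B i + X ^ 2 ^ i • E i = 1 := by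
  induction i with
  | zero => simpa using h0
  | succ i ih =>
    rw [hB, hE, pow_succ, pow_mul]
    exact quadraticLifting ih

end Identities

/-! ## §3. Dixon's iteration for `A x = b` [Dixon1982; PauderisStorjohann2012, §2.1 (1)–(3)] -/

section Dixon

variable {ι R : Type*} [Fintype ι] [DecidableEq ι] [CommRing R]

/-- A *local inverse* of `A` modulo `X`: a matrix `C` (`= Rem(A⁻¹, X)` in
[PauderisStorjohann2012, §2.1], `= A⁻¹ mod p` in [Dixon1982]) together with the quotient `E` in
`A C = I + X E`. [cite: PauderisStorjohann2012, §2.1 eq. (1) (C₀ = Rem(A⁻¹, X))] -/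
structure LocalInverse (A : Matrix ι ι R) (X : R) where
  /-- the local inverse `C` -/
  inv : Matrix ι ι R
  /-- the quotient `E` with `A C = I + X E` -/
  err : Matrix ι ι R
  /-- `A C = I + X E` -/
  mul_inv_eq : A * inv = 1 + X • err

/-- A local inverse from an inverse `u` of `det A` modulo `X` (`det A · u = 1 + X e`):
`C := u · adj(A)`, by `A adj(A) = det A · I`.
[cite: PauderisStorjohann2012, §2 p. 2 (X relatively prime to det A)] -/
def LocalInverse.ofDet (A : Matrix ι ι R) {X u e : R} (h : A.det * u = 1 + X * e) :
    LocalInverse A X where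
  inv := u • A.adjugate
  err := e • (1 : Matrix ι ι R)
  mul_inv_eq := by
    rw [Matrix.mul_smul, Matrix.mul_adjugate, smul_smul, mul_comm u, h, add_smul, one_smul,
      smul_smul]

/-- Over `ℤ`: a local inverse modulo any `X` coprime to `det A` (Bézout).
[cite: PauderisStorjohann2012, §2 p. 2 (X ⊥ det A)] -/
noncomputable def LocalInverse.ofIsCoprime (A : Matrix ι ι ℤ) {X : ℤ}
    (h : IsCoprime A.det X) : LocalInverse A X :=
  LocalInverse.ofDet A (u := Classical.choose h) (e := -Classical.choose (Classical.choose_spec h))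
    (by linear_combination Classical.choose_spec (Classical.choose_spec h))

/-- A *reduction modulo `X`* on vectors with its quotient: `reduce v + X • quot v = v`
(`Rem(·, X)` applied entrywise in [PauderisStorjohann2012], least non-negative residues in
[Dixon1982]; the identity is all the lifting uses).
[cite: PauderisStorjohann2012, §1 p. 2 (Rem applied elementwise)] -/
structure DigitReduction (ι R : Type*) [CommRing R] (X : R) where
  /-- the chosen representative modulo `X`, entrywise -/
  reduce : (ι → R) → (ι → R)
  /-- the quotient -/
  quot : (ι → R) → (ι → R)
  /-- `reduce v + X • quot v = v` -/
  reduce_add : ∀ v, reduce v + X • quot v = v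

/-- No reduction at all (`reduce = id`): the lifting identities do not need the digits reduced
(cf. [PauderisStorjohann2012, §2.3]: "the computation of the `Bᵢ` … does not include a modulo
operation"). [cite: PauderisStorjohann2012, §2.3 p. 3] -/
def DigitReduction.none (ι R : Type*) [CommRing R] (X : R) : DigitReduction ι R X where
  reduce := id
  quot := 0
  reduce_add v := by simp

/-- Over `ℤ`, digits in `[0, X)` (least non-negative residues, as in [Dixon1982]).
[cite: PauderisStorjohann2012, §2.1 p. 3 (Cᵢ = Rem(Cᵢ, X), digit reduction)] -/
def DigitReduction.emod (ι : Type*) (X : ℤ) : DigitReduction ι ℤ X where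
  reduce v := fun j => v j % X
  quot v := fun j => v j / X
  reduce_add v := by
    funext j
    simp only [Pi.add_apply, Pi.smul_apply, smul_eq_mul]
    rw [Int.emod_def]
    ring

/-- Over `ℤ`, digits in the symmetric range: `Rem(·, X)` entrywise [PauderisStorjohann2012, §1].
[cite: PauderisStorjohann2012, §1 p. 2 (Rem applied elementwise)] -/
def DigitReduction.symm (ι : Type*) (X : ℤ) : DigitReduction ι ℤ X where
  reduce v := fun j => symmRem X (v j)
  quot v := fun j => (v j - symmRem X (v j)) / X
  reduce_add v := by
    funext j
    simp only [Pi.add_apply, Pi.smul_apply, smul_eq_mul]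
    rw [Int.mul_ediv_cancel' (dvd_sub_symmRem X (v j))]
    ring

variable (A : Matrix ι ι R) {X : R} (L : LocalInverse A X) (ρ : DigitReduction ι R X) (b : ι → R)

/-- Dixon's residues `r₀ = b`, `rᵢ₊₁ = (rᵢ − A yᵢ)/X`, written without division through the
quotients: `rᵢ₊₁ = A qᵢ − E rᵢ` where `yᵢ = C rᵢ − X qᵢ` is the reduced digit and
`A C = I + X E`
(`smul_dixonResidual_succ` shows `X rᵢ₊₁ = rᵢ − A yᵢ`).
[cite: PauderisStorjohann2012, §2.1 eq. (3)] -/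
def dixonResidual : ℕ → ι → R
  | 0 => b
  | i + 1 => A *ᵥ ρ.quot (L.inv *ᵥ dixonResidual i) - L.err *ᵥ dixonResidual i

/-- Dixon's `X`-adic digits `yᵢ = Rem(C rᵢ, X)`.
[cite: PauderisStorjohann2012, §2.1 eq. (3)] -/
def dixonDigit (i : ℕ) : ι → R := ρ.reduce (L.inv *ᵥ dixonResidual A L ρ b i)

/-- The truncated `X`-adic solution `x⁽ᵏ⁾ = Σ_{i<k} Xⁱ yᵢ`.
[cite: PauderisStorjohann2012, §2.1 eq. (1)] -/
def dixonApprox (k : ℕ) : ι → R := ∑ i ∈ Finset.range k, X ^ i • dixonDigit A L ρ b i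

/-- `r₀ = b`. [cite: PauderisStorjohann2012, §2.1 eq. (1)] -/
@[simp] theorem dixonResidual_zero : dixonResidual A L ρ b 0 = b := rfl

/-- The recurrence `rᵢ₊₁ = A qᵢ − E rᵢ` (division-free form of `(rᵢ − A yᵢ)/X`).
[cite: PauderisStorjohann2012, §2.1 eq. (3)] -/
theorem dixonResidual_succ (i : ℕ) : dixonResidual A L ρ b (i + 1) =
    A *ᵥ ρ.quot (L.inv *ᵥ dixonResidual A L ρ b i) - L.err *ᵥ dixonResidual A L ρ b i := rfl

/-- `x⁽⁰⁾ = 0`. [cite: PauderisStorjohann2012, §2.1 eq. (1)] -/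
@[simp] theorem dixonApprox_zero : dixonApprox A L ρ b 0 = 0 := by simp [dixonApprox]

/-- `x⁽ᵏ⁺¹⁾ = x⁽ᵏ⁾ + Xᵏ yₖ`. [cite: PauderisStorjohann2012, §2.1 eq. (1)] -/
theorem dixonApprox_succ (k : ℕ) :
    dixonApprox A L ρ b (k + 1) = dixonApprox A L ρ b k + X ^ k • dixonDigit A L ρ b k := by
  simp [dixonApprox, Finset.sum_range_succ]

/-- The dixonDigit is the local inverse applied to the residue, reduced: `yᵢ = C rᵢ − X qᵢ`.
[cite: PauderisStorjohann2012, §2.1 eq. (3)] -/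
theorem dixonDigit_eq_sub (i : ℕ) : dixonDigit A L ρ b i =
    L.inv *ᵥ dixonResidual A L ρ b i - X • ρ.quot (L.inv *ᵥ dixonResidual A L ρ b i) :=
  eq_sub_of_add_eq (ρ.reduce_add _)

/-- **Exact division** (eq. (3) / [Dixon1982]): `X · rᵢ₊₁ = rᵢ − A yᵢ`.
[cite: PauderisStorjohann2012, §2.1 eq. (3)] -/
theorem smul_dixonResidual_succ (i : ℕ) :
    X • dixonResidual A L ρ b (i + 1) = dixonResidual A L ρ b i - A *ᵥ dixonDigit A L ρ b i := by
  rw [dixonResidual_succ, dixonDigit_eq_sub, Matrix.mulVec_sub, Matrix.mulVec_smul,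
    Matrix.mulVec_mulVec,
    L.mul_inv_eq, Matrix.add_mulVec, Matrix.one_mulVec, Matrix.smul_mulVec, smul_sub]
  abel

/-- **The lifting invariant** ([PauderisStorjohann2012, §2.1 eq. (1)] for a right-hand side;
[Dixon1982]): `A x⁽ᵏ⁾ + Xᵏ rₖ = b`; in particular `A x⁽ᵏ⁾ ≡ b (mod Xᵏ)`.
[cite: PauderisStorjohann2012, §2.1 eq. (1)] -/
theorem mulVec_dixonApprox_add (k : ℕ) :
    A *ᵥ dixonApprox A L ρ b k + X ^ k • dixonResidual A L ρ b k = b := by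
  induction k with
  | zero => simp
  | succ k ih =>
    rw [dixonApprox_succ, Matrix.mulVec_add, Matrix.mulVec_smul, pow_succ, mul_smul,
      add_assoc, ← smul_add, smul_dixonResidual_succ, add_sub_cancel]
    exact ih

/-- `A x⁽ᵏ⁾ ≡ b (mod Xᵏ)`, entrywise divisibility form.
[cite: PauderisStorjohann2012, §2.1 eq. (1)] -/
theorem sub_mulVec_dixonApprox (k : ℕ) :
    b - A *ᵥ dixonApprox A L ρ b k = X ^ k • dixonResidual A L ρ b k := by
  rw [sub_eq_iff_eq_add, add_comm]
  exact (mulVec_dixonApprox_add A L ρ b k).symm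

/-- Adjugate form of the invariant: `det A • x⁽ᵏ⁾ + Xᵏ • adj(A) rₖ = adj(A) b` (multiply
`A x⁽ᵏ⁾ + Xᵏ rₖ = b` by `adj(A)`, `adj(A) A = det A · I`) — `x⁽ᵏ⁾` is the `X`-adic expansion of
Cramer's solution `adj(A) b / det A`. [cite: PauderisStorjohann2012, §2.1 eq. (1)] -/
theorem det_smul_dixonApprox_add (k : ℕ) :
    A.det • dixonApprox A L ρ b k + X ^ k • (A.adjugate *ᵥ dixonResidual A L ρ b k) =
      A.adjugate *ᵥ b := by
  have h := congrArg (fun v => A.adjugate *ᵥ v) (mulVec_dixonApprox_add A L ρ b k)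
  simpa only [Matrix.mulVec_add, Matrix.mulVec_smul, Matrix.mulVec_mulVec, Matrix.adjugate_mul,
    Matrix.smul_mulVec, Matrix.one_mulVec] using h

end Dixon

/-! ## §4. Over `ℤ`: congruences, magnitudes, and the output criterion [Dixon1982] -/

section Integer

variable {ι : Type*} [Fintype ι] [DecidableEq ι]
variable (A : Matrix ι ι ℤ) {X : ℤ} (L : LocalInverse A X) (ρ : DigitReduction ι ℤ X) (b : ι → ℤ)

/-- `det A · x⁽ᵏ⁾ⱼ ≡ (adj(A) b)ⱼ (mod Xᵏ)` for every coordinate `j`.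
[cite: PauderisStorjohann2012, §2.1 eq. (1)] -/
theorem det_mul_dixonApprox_modEq (k : ℕ) (j : ι) :
    A.det * dixonApprox A L ρ b k j ≡ (A.adjugate *ᵥ b) j [ZMOD X ^ k] := by
  have h := congrFun (det_smul_dixonApprox_add A L ρ b k) j
  simp only [Pi.add_apply, Pi.smul_apply, smul_eq_mul] at h
  exact Int.modEq_iff_dvd.mpr ⟨(A.adjugate *ᵥ dixonResidual A L ρ b k) j, by linarith⟩

/-- `sign d · d = |d|` (private arithmetic helper). [folklore] -/
private theorem sign_mul_self' (d : ℤ) : d.sign * d = |d| := by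
  rcases lt_trichotomy d 0 with h | h | h
  · rw [Int.sign_eq_neg_one_of_neg h, abs_of_neg h]; ring
  · subst h; simp
  · rw [Int.sign_eq_one_of_pos h, abs_of_pos h]; ring

/-- `|sign d · z| ≤ |z|` (private arithmetic helper). [folklore] -/
private theorem abs_sign_mul_le (d z : ℤ) : |d.sign * z| ≤ |z| := by
  rw [abs_mul]
  rcases lt_trichotomy d 0 with h | h | h
  · rw [Int.sign_eq_neg_one_of_neg h]; simp
  · subst h; simp
  · rw [Int.sign_eq_one_of_pos h]; simp

/-- **Dixon's output criterion** [Dixon1982] (the rational-reconstruction step): if a fraction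
`u/v`, `v ≥ 0`, satisfies `v · x⁽ᵏ⁾ⱼ ≡ u (mod Xᵏ)` and both it and Cramer's fraction
`(adj(A) b)ⱼ / det A` lie inside the uniqueness range (`2|u|·|det A| < Xᵏ`,
`2|(adj(A) b)ⱼ|·v < Xᵏ`), then `u · |det A| = sign(det A)(adj(A) b)ⱼ · v` — by the tree's
`RationalReconstruction.eq_of_modEq_of_two_mul_lt` [GathenGerhard1999, Thm. 5.26 (iv)].
[cite: GathenGerhard1999, Theorem 5.26 (iv)] -/
theorem reconstruction_mul_abs_det_eq {k : ℕ} {j : ι} {u v : ℤ} (hv : 0 ≤ v)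
    (huv : v * dixonApprox A L ρ b k j ≡ u [ZMOD X ^ k]) (hu : 2 * (|u| * |A.det|) < X ^ k)
    (hz : 2 * (|(A.adjugate *ᵥ b) j| * v) < X ^ k) :
    u * |A.det| = A.det.sign * (A.adjugate *ᵥ b) j * v := by
  have h1 : |A.det| * dixonApprox A L ρ b k j ≡ A.det.sign * (A.adjugate *ᵥ b) j [ZMOD X ^ k] := by
    have := (det_mul_dixonApprox_modEq A L ρ b k j).mul_left A.det.sign
    rwa [← mul_assoc, sign_mul_self'] at this
  have hsz := abs_sign_mul_le A.det ((A.adjugate *ᵥ b) j)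
  have hz' : 2 * (|A.det.sign * (A.adjugate *ᵥ b) j| * v) < X ^ k :=
    lt_of_le_of_lt (by nlinarith [hsz, abs_nonneg (A.det.sign * (A.adjugate *ᵥ b) j)]) hz
  exact Literature.NumberTheory.RationalReconstruction.eq_of_modEq_of_two_mul_lt huv h1 hv
    (abs_nonneg _) hu hz'

/-- **Dixon's output criterion**, nonsingular form [Dixon1982]: for `det A ≠ 0`, a fraction `u/v`
(`v ≥ 0`) with `v · x⁽ᵏ⁾ⱼ ≡ u (mod Xᵏ)`, `2|u|·|det A| < Xᵏ` and `2|(adj(A) b)ⱼ|·v < Xᵏ` satisfies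
`u · det A = (adj(A) b)ⱼ · v`, i.e. `u/v` is the `j`-th coordinate of the solution `A⁻¹ b`.
[cite: GathenGerhard1999, Theorem 5.26 (iv)] -/
theorem reconstruction_mul_det_eq {k : ℕ} {j : ι} {u v : ℤ} (hd : A.det ≠ 0) (hv : 0 ≤ v)
    (huv : v * dixonApprox A L ρ b k j ≡ u [ZMOD X ^ k]) (hu : 2 * (|u| * |A.det|) < X ^ k)
    (hz : 2 * (|(A.adjugate *ᵥ b) j| * v) < X ^ k) :
    u * A.det = (A.adjugate *ᵥ b) j * v := by
  have h := reconstruction_mul_abs_det_eq A L ρ b hv huv hu hz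
  have hs : A.det.sign * A.det.sign = 1 := by
    rcases lt_or_gt_of_ne hd with h' | h'
    · rw [Int.sign_eq_neg_one_of_neg h']; norm_num
    · rw [Int.sign_eq_one_of_pos h']; norm_num
  calc u * A.det = A.det.sign * (u * |A.det|) := by
        rw [← sign_mul_self' A.det]; linear_combination (-(u * A.det)) * hs
    _ = A.det.sign * (A.det.sign * (A.adjugate *ᵥ b) j * v) := by rw [h]
    _ = (A.adjugate *ᵥ b) j * v := by
        rw [show A.det.sign * (A.det.sign * (A.adjugate *ᵥ b) j * v) =
          (A.det.sign * A.det.sign) * ((A.adjugate *ᵥ b) j * v) by ring, hs, one_mul]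

/-- The same with the usual *a priori* bounds: if `|u|, |(adj(A) b)ⱼ| ≤ N`, `0 ≤ v ≤ D`,
`|det A| ≤ D` and `2 N D < Xᵏ` (the stopping rule: lift until `Xᵏ > 2ND`, `N`, `D` e.g. Hadamard
bounds), then `u · det A = (adj(A) b)ⱼ · v`.
[cite: GathenGerhard1999, Theorem 5.26 (iv)] -/
theorem reconstruction_mul_det_eq_of_bounds {k : ℕ} {j : ι} {u v N D : ℤ} (hd : A.det ≠ 0)
    (hv : 0 ≤ v) (huv : v * dixonApprox A L ρ b k j ≡ u [ZMOD X ^ k]) (huN : |u| ≤ N)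
    (hzN : |(A.adjugate *ᵥ b) j| ≤ N) (hvD : v ≤ D) (hdD : |A.det| ≤ D) (hND : 2 * N * D < X ^ k) :
    u * A.det = (A.adjugate *ᵥ b) j * v :=
  reconstruction_mul_det_eq A L ρ b hd hv huv
    (by nlinarith [abs_nonneg u, abs_nonneg A.det, abs_nonneg ((A.adjugate *ᵥ b) j)])
    (by nlinarith [abs_nonneg u, abs_nonneg A.det, abs_nonneg ((A.adjugate *ᵥ b) j)])

/-- Over `ℚ`: under the hypotheses of `reconstruction_mul_det_eq` with `v > 0`,
`u / v = (adj(A) b)ⱼ / det A = (A⁻¹ b)ⱼ`. [cite: GathenGerhard1999, Theorem 5.26 (iv)] -/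
theorem reconstruction_div_eq {k : ℕ} {j : ι} {u v : ℤ} (hd : A.det ≠ 0) (hv : 0 < v)
    (huv : v * dixonApprox A L ρ b k j ≡ u [ZMOD X ^ k]) (hu : 2 * (|u| * |A.det|) < X ^ k)
    (hz : 2 * (|(A.adjugate *ᵥ b) j| * v) < X ^ k) :
    (u : ℚ) / v = ((A.adjugate *ᵥ b) j : ℚ) / A.det := by
  rw [div_eq_div_iff (by exact_mod_cast hv.ne') (by exact_mod_cast hd)]
  exact_mod_cast reconstruction_mul_det_eq A L ρ b hd hv.le huv hu hz

/-! ### Magnitudes with digits in `[0, X)` [Dixon1982]: the iteration runs in fixed precision -/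

/-- Digits of the `[0, X)` reduction are in `[0, X)`.
[cite: PauderisStorjohann2012, §2.1 p. 3 (Cᵢ = Rem(Cᵢ, X), digit reduction)] -/
theorem dixonDigit_emod_nonneg (hX : 0 < X) (L : LocalInverse A X) (i : ℕ) (j : ι) :
    0 ≤ dixonDigit A L (DigitReduction.emod ι X) b i j :=
  Int.emod_nonneg _ hX.ne'

/-- Digits of the `[0, X)` reduction are in `[0, X)`.
[cite: PauderisStorjohann2012, §2.1 p. 3 (Cᵢ = Rem(Cᵢ, X), digit reduction)] -/
theorem dixonDigit_emod_lt (hX : 0 < X) (L : LocalInverse A X) (i : ℕ) (j : ι) :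
    dixonDigit A L (DigitReduction.emod ι X) b i j < X :=
  Int.emod_lt_of_pos _ hX

/-- `0 ≤ x⁽ᵏ⁾ⱼ` for the `[0, X)` reduction.
[cite: PauderisStorjohann2012, §2.1 p. 3 (Cᵢ = Rem(Cᵢ, X), digit reduction)] -/
theorem dixonApprox_emod_nonneg (hX : 0 < X) (L : LocalInverse A X) (k : ℕ) (j : ι) :
    0 ≤ dixonApprox A L (DigitReduction.emod ι X) b k j := by
  induction k with
  | zero => simp
  | succ k ih =>
    rw [dixonApprox_succ, Pi.add_apply, Pi.smul_apply, smul_eq_mul]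
    exact add_nonneg ih (mul_nonneg (pow_nonneg hX.le k) (dixonDigit_emod_nonneg A b hX L k j))

/-- `x⁽ᵏ⁾ⱼ < Xᵏ` for the `[0, X)` reduction: `x⁽ᵏ⁾` is the `k`-dixonDigit `X`-adic truncation.
[cite: PauderisStorjohann2012, §2.1 p. 3 (Cᵢ = Rem(Cᵢ, X), digit reduction)] -/
theorem dixonApprox_emod_lt (hX : 0 < X) (L : LocalInverse A X) (k : ℕ) (j : ι) :
    dixonApprox A L (DigitReduction.emod ι X) b k j < X ^ k := by
  induction k with
  | zero => simp
  | succ k ih =>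
    rw [dixonApprox_succ, Pi.add_apply, Pi.smul_apply, smul_eq_mul, pow_succ]
    have h1 := dixonDigit_emod_lt A b hX L k j
    have h2 : X ^ k * dixonDigit A L (DigitReduction.emod ι X) b k j ≤ X ^ k * (X - 1) :=
      mul_le_mul_of_nonneg_left (by linarith) (pow_nonneg hX.le k)
    nlinarith [pow_pos hX k]

/-- Digits in the symmetric range: `2 |yᵢⱼ| ≤ X` [PauderisStorjohann2012, Lemma 1].
[cite: PauderisStorjohann2012, Lemma 1] -/
theorem two_mul_abs_dixonDigit_symm_le (hX : 0 < X) (L : LocalInverse A X) (i : ℕ) (j : ι) :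
    2 * |dixonDigit A L (DigitReduction.symm ι X) b i j| ≤ X :=
  two_mul_abs_symmRem_le hX _

omit [DecidableEq ι] in
/-- Entrywise bound `|(A y)ⱼ| ≤ n · α · β` for `|A j l| ≤ α`, `|y l| ≤ β`.
[cite: PauderisStorjohann2012, Theorem 5 (cf.: entrywise matrix–vector bound)] -/
theorem abs_mulVec_apply_le_card_mul {α β : ℤ} (hA : ∀ j l, |A j l| ≤ α) {y : ι → ℤ}
    (hy : ∀ l, |y l| ≤ β)
    (j : ι) : |(A *ᵥ y) j| ≤ Fintype.card ι * (α * β) := by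
  calc |(A *ᵥ y) j| = |∑ l, A j l * y l| := rfl
    _ ≤ ∑ l, |A j l * y l| := Finset.abs_sum_le_sum_abs _ _
    _ ≤ ∑ _l : ι, α * β := Finset.sum_le_sum fun l _ => by
        rw [abs_mul]
        exact mul_le_mul (hA j l) (hy l) (abs_nonneg _) ((abs_nonneg _).trans (hA j l))
    _ = Fintype.card ι * (α * β) := by
        rw [Finset.sum_const, Finset.card_univ, nsmul_eq_mul]

/-- **The residues stay small** [Dixon1982]: with digits in `[0, X)`, entries `|A j l| ≤ α` and a
bound `B ≥ ‖b‖∞` with `n α ≤ B`, every residue satisfies `‖rᵢ‖∞ ≤ B` — from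
`X rᵢ₊₁ = rᵢ − A yᵢ` and `|(A yᵢ)ⱼ| ≤ n α (X − 1)`: `X |rᵢ₊₁,ⱼ| ≤ B + nα(X−1) ≤ B X`. So Dixon's
iteration never leaves the precision `max(‖b‖∞, n‖A‖∞)` (cf. the matrix analogue
[PauderisStorjohann2012, Thm. 5]: `‖Rᵢ‖ < 0.6001 n ‖A‖`).
[cite: PauderisStorjohann2012, Theorem 5 (cf. (9): vector analogue)] -/
theorem abs_dixonResidual_le (hX : 0 < X) (L : LocalInverse A X) {α B : ℤ} (hA : ∀ j l, |A j l| ≤ α)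
    (hb : ∀ j, |b j| ≤ B) (hB : Fintype.card ι * α ≤ B) (i : ℕ) (j : ι) :
    |dixonResidual A L (DigitReduction.emod ι X) b i j| ≤ B := by
  induction i generalizing j with
  | zero => simpa using hb j
  | succ i ih =>
    have key := congrFun (smul_dixonResidual_succ A L (DigitReduction.emod ι X) b i) j
    simp only [Pi.smul_apply, smul_eq_mul, Pi.sub_apply] at key
    have hy : ∀ l, |dixonDigit A L (DigitReduction.emod ι X) b i l| ≤ X - 1 := fun l => by
      rw [abs_of_nonneg (dixonDigit_emod_nonneg A b hX L i l)]
      have := dixonDigit_emod_lt A b hX L i l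
      omega
    have hAy := abs_mulVec_apply_le_card_mul A hA hy j
    have hα : 0 ≤ α := by
      rcases isEmpty_or_nonempty ι with hι | ⟨⟨l⟩⟩
      · exact (abs_nonneg _).trans (hA j j)
      · exact (abs_nonneg _).trans (hA j j)
    have h1 : |X * dixonResidual A L (DigitReduction.emod ι X) b (i + 1) j| ≤
        B + Fintype.card ι * (α * (X - 1)) := by
      rw [key]
      exact (abs_sub _ _).trans (add_le_add (ih j) hAy)
    rw [abs_mul, abs_of_pos hX] at h1
    have h2 : (Fintype.card ι : ℤ) * (α * (X - 1)) ≤ B * (X - 1) := by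
      rw [← mul_assoc]
      exact mul_le_mul_of_nonneg_right hB (by linarith)
    exact le_of_mul_le_mul_left (by linarith) hX

end Integer

end Literature.LinearAlgebra.Matrix.XAdicLifting
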